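import Summits.BirchSwinnertonDyer.BirchSwinnertonDyer.Theses.BiquadraticEisensteinDescent
import Summits.BirchSwinnertonDyer.BirchSwinnertonDyer.Theorems.TeichmullerTwistDescentCellsOfCDT
import Literature.NumberTheory.EllipticCurves.ComplexMultiplicationNotSemistable
import HarnessLib

/-!
# Route `BiquadraticEisensteinDescent`: the CM Manin data at `p ∈ {5, 7}` — `ManinDatumFiveSevenCMInert` (20242, the declared
# residual R₅₇ bound by `closes`) and `ManinDatumSupercuspidalCMInert` (20111) — and the rung W-ALL/corner-F, MODULO THE PRINTED
# CALEGARI–DIMITROV–TANG UNBOUNDED-DENOMINATORS THEOREM ONLY — `--supports`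

Cell `pub/bsd-wall`, seat `bsd-line-ttd-p1` (prover 1/2 on the line TeichmullerTwistDescent, g31; cross-route helper for the BED pen,
announced on STATUS). THEOREMS ONLY (no definition, no named fact, no `sorry`); every theorem is `proof.conditional` on ONE cite-only
PRINTED fact, the vendored unbounded-denominators theorem
`Literature.NumberTheory.Automorphic.CalegariDimitrovTang2025_unboundedDenominators_algInt` («CDT»; Calegari–Dimitrov–Tang, J. Amer. Math.
Soc. 38 (2025), Thm. 1, Remarks 58–59); nothing is closed by name; BSD is not proved; Manin's conjecture is not proved unconditionally;
no Manin theorem is announced (director-bsd (505)/(527): «closed modulo CDT; items open»).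

WHAT THIS FILE DOES. A CM curve with bad reduction at `p` is ADDITIVE there (`Rank1Residual.not_mult_of_hasCM`, Silverman ATAEC
II.6.4), so both CM Manin data are instances of `TeichmullerTwistDescent.not_dvd_c_of_CDT` (p769544: `p ∤ c(D)` at every
lattice-optimal datum of every globally minimal curve additive at `p ≥ 5`, modulo CDT — one line over the cell bsd-f2-manin's
`CDivisionUDC.abs_maninConstant_eq_one_of_CDT_of_odd_sq_dvd`, p755101). The CM / rank / inertness / Kodaira clauses are idle.
(§1) `maninDatumFiveSevenCMInert_of_CDT` (20242), `maninDatumSupercuspidalCMInert_of_CDT` (20111); (§2) the rung `WAllCornerFInertBad` ⟸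
CDT ∧ the route's other eight `closes` hypotheses (20242 is NOT one of them any more).

HONEST STATUS: CONDITIONAL on the printed CDT fact (the cell bsd-f2-manin's trust base; audits (505)/(527) pending); the items stay
OPEN by name. BSD is not proved by this; Manin's conjecture is not proved by this. [cite: CalegariDimitrovTang2025, Thm. 1 and Remarks 58–59]
[cite: SilvermanATAEC1994, Thm. II.6.4 (CM curves have no multiplicative reduction)] [cite: LingOesterle1991, Thm. 6]
-/

set_option autoImplicit false
-- single-conjunct summit: `Summit.BirchSwinnertonDyer.BirchSwinnertonDyer.…` repeats the name by design
set_option linter.dupNamespace false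

noncomputable section

open scoped Classical

open WeierstrassCurve Literature.NumberTheory.EllipticCurves Literature.NumberTheory.EllipticCurves.ModularForms
  Literature.NumberTheory.EllipticCurves.Rank1Residual
  Summit.BirchSwinnertonDyer.BirchSwinnertonDyer.Theses.BiquadraticEisensteinDescent
  Summit.BirchSwinnertonDyer.BirchSwinnertonDyer.Theorems

namespace Summit.BirchSwinnertonDyer.BirchSwinnertonDyer.Theorems.BiquadraticEisensteinDescentOfCDT

/-! ### §1 The two CM Manin data, BY NAME, modulo CDT -/

/-- **R₅₇ `ManinDatumFiveSevenCMInert` (stmt-BirchSwinnertonDyer-20242) ⟸ CDT**: a CM curve of analytic rank `1`, `p ∈ {5,7}` inert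
and bad, lattice-optimal conductor-level datum ⟹ `p ∤ c`. CM + bad ⟹ additive (`not_mult_of_hasCM`); then
`TeichmullerTwistDescent.not_dvd_c_of_CDT`. CONDITIONAL on `hCDT`; the item is not closed by this; BSD is not proved by this.
[cite: CalegariDimitrovTang2025, Thm. 1 and Remarks 58–59] [cite: SilvermanATAEC1994, Thm. II.6.4] -/
theorem maninDatumFiveSevenCMInert_of_CDT
    (hCDT : Literature.NumberTheory.Automorphic.CalegariDimitrovTang2025_unboundedDenominators_algInt) :
    ManinDatumFiveSevenCMInert := by
  intro W _ _ _ p _ D hCM _hr h57 _hin hbad hlat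
  have hp5 : 5 ≤ p := by rcases h57 with rfl | rfl <;> omega
  have hadd : Addv W p := ⟨hbad, not_mult_of_hasCM W hCM p⟩
  exact TeichmullerTwistDescent.not_dvd_c_of_CDT hCDT D hp5 hadd hlat

/-- **`ManinDatumSupercuspidalCMInert` (stmt-BirchSwinnertonDyer-20111: the semistability-defect `e ∈ {3,4,6}` CM cells, `j = 0` at
`5` / `j = 1728` at `7`) ⟸ CDT** (Kodaira clauses idle). CONDITIONAL on `hCDT`; the item is not closed by this; BSD is not proved by
this. [cite: CalegariDimitrovTang2025, Thm. 1 and Remarks 58–59] [cite: SilvermanATAEC1994, Thm. II.6.4] -/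
theorem maninDatumSupercuspidalCMInert_of_CDT
    (hCDT : Literature.NumberTheory.Automorphic.CalegariDimitrovTang2025_unboundedDenominators_algInt) :
    ManinDatumSupercuspidalCMInert := by
  intro W _ _ _ p _ D _v _hv hCM _hr h57 _hin hbad hlat _hcell
  have hp5 : 5 ≤ p := by rcases h57 with rfl | rfl <;> omega
  have hadd : Addv W p := ⟨hbad, not_mult_of_hasCM W hCM p⟩
  exact TeichmullerTwistDescent.not_dvd_c_of_CDT hCDT D hp5 hadd hlat

/-! ### §2 The rung W-ALL/corner-F modulo CDT and the route's other items -/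

/-- **The rung `WAllCornerFInertBad` ⟸ CDT ∧ the route's other eight `closes` hypotheses** (`EisensteinDivisibilityCMInertBadFlatAtOneKPrime`,
`KatzWaldspurgerFrameCMInertBadFlatKPrimeOfLZZ`, `InertBadAtThree`, `PublishedInputsBiquadratic`, `HeegnerFieldSupplyCMInertBadKPrime`,
`HsiehAnyLevelInput`, `HsiehMuInvariantInput`, `LiuZhangZhangAdditiveInput`) — the residual R₅₇ (20242) is fed from §1 and is NOT a
hypothesis. CONDITIONAL; no item is closed by this; BSD is not proved and no W-ALL class theorem is proved by this.
[cite: CalegariDimitrovTang2025, Thm. 1 and Remarks 58–59] -/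
theorem wAllCornerFInertBad_of_CDT_of_items
    (hCDT : Literature.NumberTheory.Automorphic.CalegariDimitrovTang2025_unboundedDenominators_algInt)
    (h1 : EisensteinDivisibilityCMInertBadFlatAtOneKPrime) (h2 : KatzWaldspurgerFrameCMInertBadFlatKPrimeOfLZZ)
    (h4 : InertBadAtThree) (h6 : PublishedInputsBiquadratic) (h7 : HeegnerFieldSupplyCMInertBadKPrime)
    (h8 : HsiehAnyLevelInput) (h9 : HsiehMuInvariantInput) (h10 : LiuZhangZhangAdditiveInput) :
    Summit.BirchSwinnertonDyer.WAllCornerFInertBad :=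
  closes h1 h2 h4 (maninDatumFiveSevenCMInert_of_CDT hCDT) h6 h7 h8 h9 h10

end Summit.BirchSwinnertonDyer.BirchSwinnertonDyer.Theorems.BiquadraticEisensteinDescentOfCDT

end
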